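import Mathlib

/-!
# Counting and calculus lemmas for the pinning lemma (pinning-lemma toolkit, II)

Route `PlantedPinning` of `Ising3DConformalLimit`, support item stmt-CriticalPhenomena-8455
(`PinningEfficiencyLeOne`).  Three elementary ingredients of the pinning lemma
(Raghavendra–Tan 2012; Montanari 2008), free of any probability:

* `sum_powersetCard_sum_sdiff_insert` — double counting
  `∑_{|P| = j} ∑_{z ∈ Λ ∖ P} F(P ∪ {z}) = (j+1) ∑_{|Q| = j+1} F(Q)`;
* `sq_wsum_le_wsum_sq` — Jensen for a probability weight, `(∑ w X)² ≤ ∑ w X²`;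
* `riccati_bound` — the discrete Riccati inequality `v_{j+1} ≤ v_j − v_j²/(n−j)²`, `v ≥ 0`,
  forces `k v_k ≤ (n+1)(n−k+1)` (i.e. `1/v_k ≥ ∑_{i<k} 1/((n−i)(n−i+1)) = k/((n+1)(n−k+1))`).
-/

namespace Summit.CriticalPhenomena.Ising3DConformalLimit.PlantedPinningCeiling

open Finset

/-- **Double counting of (pin set, new pin) pairs**:
`∑_{P ⊆ Λ, |P| = j} ∑_{z ∈ Λ ∖ P} F(insert z P) = (j+1) · ∑_{Q ⊆ Λ, |Q| = j+1} F(Q)`. [folklore] -/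
theorem sum_powersetCard_sum_sdiff_insert {V : Type*} [DecidableEq V] (Λ : Finset V) (j : ℕ)
    (F : Finset V → ℝ) :
    ∑ P ∈ Λ.powersetCard j, ∑ z ∈ Λ \ P, F (insert z P) =
      ((j : ℝ) + 1) * ∑ Q ∈ Λ.powersetCard (j + 1), F Q := by
  have h1 : ∑ P ∈ Λ.powersetCard j, ∑ z ∈ Λ \ P, F (insert z P) =
      ∑ x ∈ (Λ.powersetCard j).sigma (fun P => Λ \ P), F (insert x.2 x.1) := by
    rw [Finset.sum_sigma]
  have h2 : ∑ Q ∈ Λ.powersetCard (j + 1), ∑ _z ∈ Q, F Q =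
      ∑ y ∈ (Λ.powersetCard (j + 1)).sigma (fun Q => Q), F y.1 := by
    rw [Finset.sum_sigma]
  have h3 : ∑ x ∈ (Λ.powersetCard j).sigma (fun P => Λ \ P), F (insert x.2 x.1) =
      ∑ y ∈ (Λ.powersetCard (j + 1)).sigma (fun Q => Q), F y.1 := by
    refine Finset.sum_bij' (fun x _ => ⟨insert x.2 x.1, x.2⟩) (fun y _ => ⟨y.1.erase y.2, y.2⟩)
      ?_ ?_ ?_ ?_ ?_
    · rintro ⟨P, z⟩ hx
      simp only [Finset.mem_sigma, Finset.mem_powersetCard, Finset.mem_sdiff] at hx ⊢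
      obtain ⟨⟨hPΛ, hcard⟩, hzΛ, hzP⟩ := hx
      refine ⟨⟨Finset.insert_subset hzΛ hPΛ, ?_⟩, Finset.mem_insert_self z P⟩
      rw [Finset.card_insert_of_notMem hzP, hcard]
    · rintro ⟨Q, z⟩ hy
      simp only [Finset.mem_sigma, Finset.mem_powersetCard, Finset.mem_sdiff] at hy ⊢
      obtain ⟨⟨hQΛ, hcard⟩, hzQ⟩ := hy
      refine ⟨⟨(Finset.erase_subset z Q).trans hQΛ, ?_⟩, hQΛ hzQ, Finset.notMem_erase z Q⟩
      rw [Finset.card_erase_of_mem hzQ, hcard, Nat.add_sub_cancel]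
    · rintro ⟨P, z⟩ hx
      simp only [Finset.mem_sigma, Finset.mem_powersetCard, Finset.mem_sdiff] at hx
      simp only [Finset.erase_insert hx.2.2]
    · rintro ⟨Q, z⟩ hy
      simp only [Finset.mem_sigma, Finset.mem_powersetCard] at hy
      simp only [Finset.insert_erase hy.2]
    · rintro ⟨P, z⟩ _
      rfl
  have h4 : ∑ Q ∈ Λ.powersetCard (j + 1), ∑ _z ∈ Q, F Q =
      ((j : ℝ) + 1) * ∑ Q ∈ Λ.powersetCard (j + 1), F Q := by
    rw [Finset.mul_sum]
    refine Finset.sum_congr rfl fun Q hQ => ?_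
    rw [Finset.sum_const, nsmul_eq_mul, (Finset.mem_powersetCard.1 hQ).2]
    push_cast
    ring
  rw [h1, h3, ← h2, h4]

/-- **Jensen / Cauchy–Schwarz for a probability weight**: `(∑ w X)² ≤ ∑ w X²` when `w ≥ 0` and
`∑ w = 1`. [folklore] -/
theorem sq_wsum_le_wsum_sq {Ω : Type*} [Fintype Ω] {w : Ω → ℝ} (hw : ∀ ω, 0 ≤ w ω)
    (hw1 : ∑ ω, w ω = 1) (X : Ω → ℝ) :
    (∑ ω, w ω * X ω) ^ 2 ≤ ∑ ω, w ω * X ω ^ 2 := by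
  set m := ∑ ω, w ω * X ω with hm
  clear_value m
  have hnonneg : 0 ≤ ∑ ω, w ω * (X ω - m) ^ 2 :=
    Finset.sum_nonneg fun ω _ => mul_nonneg (hw ω) (sq_nonneg _)
  have hexp : ∑ ω, w ω * (X ω - m) ^ 2 =
      ∑ ω, w ω * X ω ^ 2 - 2 * m * ∑ ω, w ω * X ω + m ^ 2 * ∑ ω, w ω := by
    rw [Finset.mul_sum, Finset.mul_sum, ← Finset.sum_sub_distrib, ← Finset.sum_add_distrib]
    exact Finset.sum_congr rfl fun ω _ => by ring
  rw [hw1, mul_one] at hexp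
  subst hm
  nlinarith [hnonneg, hexp]

/-- **The discrete Riccati inequality of the pinning lemma**: if `v ≥ 0` and
`v (j+1) ≤ v j − (v j)² / (n − j)²` for `j < n`, then `k · v k ≤ (n+1)(n−k+1)` for `k ≤ n`
(Raghavendra–Tan 2012, proof of the pinning lemma: `1/v_{j+1} ≥ 1/v_j + 1/(n−j)²`, summed).
[folklore] -/
theorem riccati_bound {n : ℕ} {v : ℕ → ℝ} (h0 : ∀ j, 0 ≤ v j)
    (hstep : ∀ j, j < n → v (j + 1) ≤ v j - (v j) ^ 2 / ((n : ℝ) - j) ^ 2)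
    {k : ℕ} (hkn : k ≤ n) :
    (k : ℝ) * v k ≤ ((n : ℝ) + 1) * ((n : ℝ) - k + 1) := by
  -- the reciprocal form, by induction on `j`
  have claim : ∀ j, j ≤ n → 0 < v j →
      (j : ℝ) / (((n : ℝ) + 1) * ((n : ℝ) - j + 1)) ≤ 1 / v j := by
    intro j
    induction j with
    | zero =>
      intro _ hv
      rw [Nat.cast_zero, zero_div]
      positivity
    | succ j ih =>
      intro hj1 hv1
      have hjn : j < n := hj1
      have hs := hstep j hjn
      set m : ℝ := (n : ℝ) - j with hm
      have hm1 : 1 ≤ m := by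
        have : (j : ℝ) + 1 ≤ n := by exact_mod_cast hjn
        rw [hm]; linarith
      have hm0 : 0 < m := by linarith
      have hdiv : 0 ≤ (v j) ^ 2 / m ^ 2 := by positivity
      have hle : v (j + 1) ≤ v j := by linarith
      have hvj : 0 < v j := lt_of_lt_of_le hv1 hle
      have ih' := ih hjn.le hvj
      -- `1 / v j + 1 / m² ≤ 1 / v (j+1)`
      have h2 : v (j + 1) * m ^ 2 ≤ v j * m ^ 2 - (v j) ^ 2 := by
        have := mul_le_mul_of_nonneg_right hs (sq_nonneg m)
        rwa [sub_mul, div_mul_cancel₀ _ (by positivity : m ^ 2 ≠ 0)] at this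
      have hkey : 1 / v j + 1 / m ^ 2 ≤ 1 / v (j + 1) := by
        rw [div_add_div _ _ hvj.ne' (by positivity), div_le_div_iff₀ (by positivity) hv1]
        nlinarith [h2, mul_nonneg hvj.le (sub_nonneg.2 hle)]
      -- `(j+1) / ((n+1) m) ≤ j / ((n+1)(m+1)) + 1 / m²`
      have hn : (n : ℝ) = m + j := by rw [hm]; ring
      have harith : ((j : ℝ) + 1) / (((n : ℝ) + 1) * m) ≤
          (j : ℝ) / (((n : ℝ) + 1) * ((n : ℝ) - j + 1)) + 1 / m ^ 2 := by
        have hmj : (n : ℝ) - j + 1 = m + 1 := by rw [hm]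
        rw [hmj, hn, div_add_div _ _ (by positivity) (by positivity),
          div_le_div_iff₀ (by positivity) (by positivity)]
        nlinarith [hm0, sq_nonneg m, mul_pos hm0 hm0, (Nat.cast_nonneg j : (0:ℝ) ≤ j),
          mul_nonneg (mul_nonneg hm0.le hm0.le) (Nat.cast_nonneg j)]
      have hcast : ((j + 1 : ℕ) : ℝ) = (j : ℝ) + 1 := by push_cast; ring
      have hden : (n : ℝ) - ((j : ℝ) + 1) + 1 = m := by rw [hm]; ring
      rw [hcast, hden]
      linarith [harith, ih', hkey]
  have hnk : (0 : ℝ) < (n : ℝ) - k + 1 := by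
    have : (k : ℝ) ≤ n := by exact_mod_cast hkn
    linarith
  by_cases hv : v k = 0
  · rw [hv, mul_zero]; positivity
  · have hvpos : 0 < v k := lt_of_le_of_ne (h0 k) (Ne.symm hv)
    have := claim k hkn hvpos
    rw [div_le_div_iff₀ (by positivity) hvpos] at this
    linarith

end Summit.CriticalPhenomena.Ising3DConformalLimit.PlantedPinningCeiling
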